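import Summits.QuantumFields.YangMills.Theorems.LuscherReductionTwistedTraceScalingInnerTwoZone
import HarnessLib

/-!
# C4 INNER, two zones: on the CORE radius `β^{−s}`, `s > 1/6`, the first-order OFF-DIAGONAL and second-order DIAGONAL budgets of the Feshbach package ARE met
# (lane A of S-BASE, crux `TwistedTraceScaling` stmt-QuantumFields-20203; design note `pub/ym-fleet/ym-luscher-20007-p1/COARSE-DESIGN.md` §22.1–§22.3, §22.7)

The positive counterpart of the disprover's `offDiag_budget_false_of_first_order (p < 1/6)` and `diag_budget_false_of_second_order`
(`Theorems/TwistedTraceScaling/Negative/ModelPerturbedNearRigidity.lean`; sharp at `p = 1/6`, `offDiag_budget_at_one_sixth`): once the slow datum is cut at the CORE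
radius `powScale s`, `s > 1/6` (the two-zone split `…InnerTwoZone`, record `s = 1/5`), a first-order off-diagonal constant `b = κ·β^{−s}` satisfies OFF-DIAG's
`b² ≤ εθλ_b(L³β)/16` and a second-order diagonal constant `η₂ = κ·β^{−2s}` satisfies SLOW's `η₂ ≤ ελ_b(L³β)` eventually, for EVERY `κ` (`≥ 0` for the diagonal), `ε, θ > 0`
(`β^{−2s} = β^{−(2s−1/3)}·β^{−1/3}` and `λ_b(L³β) = (2/L³)^{1/3}β^{−1/3}`): `offDiag_budget_of_core`, `diag_budget_of_core`, and the instances at `s = 1/5`.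
HONEST FRAMING: exponent bookkeeping for the CONDITIONAL fixed-lattice programme (route R2b1); not infinite volume, not a gap, not Clay.
-/

set_option autoImplicit false

noncomputable section

open Real
open Literature.MathematicalPhysics.QuantumFieldTheory
open Literature.MathematicalPhysics.QuantumLattice

namespace Summit.QuantumFields.YangMills.Theorems.FemtoTransferGap

variable {L : ℕ} [NeZero L]

/-- `powScale s β ^ 2 = β^{−(2s − 1/3)} · β^{−1/3}` for `β ≥ 1`. [folklore] -/
theorem powScale_sq_split {s β : ℝ} (hβ : 1 ≤ β) : powScale s β ^ 2 = β ^ (-(2 * s - 1 / 3)) * β ^ (-(1 : ℝ) / 3) := by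
  have hβ0 : 0 < β := by linarith
  rw [powScale_eq hβ, ← Real.rpow_natCast, ← Real.rpow_mul hβ0.le, ← Real.rpow_add hβ0]
  congr 1; push_cast; ring

/-- `powScale (2s) β = β^{−(2s − 1/3)} · β^{−1/3}` for `β ≥ 1`. [folklore] -/
theorem powScale_two_mul_split {s β : ℝ} (hβ : 1 ≤ β) : powScale (2 * s) β = β ^ (-(2 * s - 1 / 3)) * β ^ (-(1 : ℝ) / 3) := by
  have hβ0 : 0 < β := by linarith
  rw [powScale_eq hβ, ← Real.rpow_add hβ0]
  congr 1; ring

/-- ★ **OFF-DIAGONAL budget on the core**: for `s > 1/6`, `κ ≥ 0`, `ε, θ > 0`, eventually in `β` the first-order constant `b = κ·powScale s β` satisfies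
`b² ≤ ε·θ·λ_b(L³β)/16` (any real `κ`) — the positive side of the sharp pair with `offDiag_budget_false_of_first_order (p < 1/6)`. [cite: Luscher1983, §3] -/
theorem offDiag_budget_of_core {s κ ε θ : ℝ} (hs : 1 / 6 < s) (hε : 0 < ε) (hθ : 0 < θ) :
    ∃ β0 : ℝ, ∀ β : ℝ, β0 ≤ β → ∃ b : ℝ, κ * powScale s β ≤ b ∧ b ^ 2 ≤ ε * θ * bareLambda ((L : ℝ) ^ 3 * β) / 16 := by
  have hL : (0 : ℝ) < (L : ℝ) ^ 3 := by
    have : (0 : ℝ) < L := by exact_mod_cast Nat.pos_of_ne_zero (NeZero.ne L)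
    positivity
  set cL : ℝ := (2 / (L : ℝ) ^ 3) ^ ((1 : ℝ) / 3) with hcL
  have hcL0 : 0 < cL := by rw [hcL]; positivity
  have hq : 0 < 2 * s - 1 / 3 := by linarith
  obtain ⟨β0, h⟩ := rpow_neg_eventually_le hq (M := ε * θ * cL / (16 * (κ ^ 2 + 1))) (by positivity)
  refine ⟨β0, fun β hβ => ⟨κ * powScale s β, le_rfl, ?_⟩⟩
  obtain ⟨hβ1, hle⟩ := h β hβ
  have hβ0 : 0 < β := by linarith
  rw [mul_pow, powScale_sq_split hβ1, bareLambda_cube_eq (L := L) hβ0, ← hcL]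
  have hb3 : 0 < β ^ (-(1 : ℝ) / 3) := Real.rpow_pos_of_pos hβ0 _
  have h1 : κ ^ 2 * (β ^ (-(2 * s - 1 / 3)) * β ^ (-(1 : ℝ) / 3)) ≤ κ ^ 2 * (ε * θ * cL / (16 * (κ ^ 2 + 1)) * β ^ (-(1 : ℝ) / 3)) :=
    mul_le_mul_of_nonneg_left (mul_le_mul_of_nonneg_right hle hb3.le) (sq_nonneg κ)
  have h2 : κ ^ 2 * (ε * θ * cL / (16 * (κ ^ 2 + 1)) * β ^ (-(1 : ℝ) / 3)) ≤ ε * θ * (cL * β ^ (-(1 : ℝ) / 3)) / 16 := by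
    rw [show κ ^ 2 * (ε * θ * cL / (16 * (κ ^ 2 + 1)) * β ^ (-(1 : ℝ) / 3)) = (κ ^ 2 / (κ ^ 2 + 1)) * (ε * θ * (cL * β ^ (-(1 : ℝ) / 3)) / 16) by
      field_simp]
    have hk : κ ^ 2 / (κ ^ 2 + 1) ≤ 1 := by rw [div_le_one (by positivity)]; linarith
    have hpos : 0 ≤ ε * θ * (cL * β ^ (-(1 : ℝ) / 3)) / 16 := by positivity
    nlinarith
  exact h1.trans h2

/-- ★ **DIAGONAL (SLOW) budget on the core**: for `s > 1/6`, `κ ≥ 0`, `ε > 0`, eventually the second-order constant `η₂ = κ·powScale (2s) β` satisfies `η₂ ≤ ε·λ_b(L³β)` —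
the positive side of `diag_budget_false_of_second_order`. [cite: Luscher1983, §3] -/
theorem diag_budget_of_core {s κ ε : ℝ} (hs : 1 / 6 < s) (hκ : 0 ≤ κ) (hε : 0 < ε) :
    ∃ β0 : ℝ, ∀ β : ℝ, β0 ≤ β → ∃ η₂ : ℝ, κ * powScale (2 * s) β ≤ η₂ ∧ η₂ ≤ ε * bareLambda ((L : ℝ) ^ 3 * β) := by
  have hL : (0 : ℝ) < (L : ℝ) ^ 3 := by
    have : (0 : ℝ) < L := by exact_mod_cast Nat.pos_of_ne_zero (NeZero.ne L)
    positivity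
  set cL : ℝ := (2 / (L : ℝ) ^ 3) ^ ((1 : ℝ) / 3) with hcL
  have hcL0 : 0 < cL := by rw [hcL]; positivity
  have hq : 0 < 2 * s - 1 / 3 := by linarith
  obtain ⟨β0, h⟩ := rpow_neg_eventually_le hq (M := ε * cL / (κ + 1)) (by positivity)
  refine ⟨β0, fun β hβ => ⟨κ * powScale (2 * s) β, le_rfl, ?_⟩⟩
  obtain ⟨hβ1, hle⟩ := h β hβ
  have hβ0 : 0 < β := by linarith
  rw [powScale_two_mul_split hβ1, bareLambda_cube_eq (L := L) hβ0, ← hcL]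
  have hb3 : 0 < β ^ (-(1 : ℝ) / 3) := Real.rpow_pos_of_pos hβ0 _
  have h1 : κ * (β ^ (-(2 * s - 1 / 3)) * β ^ (-(1 : ℝ) / 3)) ≤ κ * (ε * cL / (κ + 1) * β ^ (-(1 : ℝ) / 3)) :=
    mul_le_mul_of_nonneg_left (mul_le_mul_of_nonneg_right hle hb3.le) hκ
  have h2 : κ * (ε * cL / (κ + 1) * β ^ (-(1 : ℝ) / 3)) ≤ ε * (cL * β ^ (-(1 : ℝ) / 3)) := by
    rw [show κ * (ε * cL / (κ + 1) * β ^ (-(1 : ℝ) / 3)) = (κ / (κ + 1)) * (ε * (cL * β ^ (-(1 : ℝ) / 3))) by field_simp]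
    have hk : κ / (κ + 1) ≤ 1 := by rw [div_le_one (by linarith)]; linarith
    have hpos : 0 ≤ ε * (cL * β ^ (-(1 : ℝ) / 3)) := by positivity
    nlinarith
  exact h1.trans h2

/-- At the core exponent of record `s = 1/5`: the OFF-DIAGONAL budget is met. [cite: Luscher1983, §3] -/
theorem offDiag_budget_at_one_fifth {κ ε θ : ℝ} (hε : 0 < ε) (hθ : 0 < θ) :
    ∃ β0 : ℝ, ∀ β : ℝ, β0 ≤ β → ∃ b : ℝ, κ * powScale (1 / 5) β ≤ b ∧ b ^ 2 ≤ ε * θ * bareLambda ((L : ℝ) ^ 3 * β) / 16 :=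
  offDiag_budget_of_core (by norm_num) hε hθ

/-- At the core exponent of record `s = 1/5`: the DIAGONAL budget is met (`powScale (2/5)`). [cite: Luscher1983, §3] -/
theorem diag_budget_at_one_fifth {κ ε : ℝ} (hκ : 0 ≤ κ) (hε : 0 < ε) :
    ∃ β0 : ℝ, ∀ β : ℝ, β0 ≤ β → ∃ η₂ : ℝ, κ * powScale (2 * (1 / 5)) β ≤ η₂ ∧ η₂ ≤ ε * bareLambda ((L : ℝ) ^ 3 * β) :=
  diag_budget_of_core (by norm_num) hκ hε

end Summit.QuantumFields.YangMills.Theorems.FemtoTransferGap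

end
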